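import Summits.QuantumFields.BalabanUV.T4Continuum.Support.MinimalActionFinalApprox
import HarnessLib

/-!
# T⁴ programme, node NE3 (η-rate of the minimisers) — THE ACTION SANDWICH, final assembly, part 5:
# THE CLASS-AGNOSTIC END — (H∃) over ANY class family containing a small-field ball ⇒ `ActionRate … (L⁻²)`

NE3 prover lineage P1, gen 18 (cell `pub-balaban`, unit `b2b-balaban-t4-ne3-p1`, `HOME/BINDER-OWNERS.md` row NE3 OWNER;
skeleton `t4/b2b-balaban-t4-ne3-p1/SKELETON-NE3-P1.md` v1.5).

WHY.  The cell's class `sfClass d L N ε k` (unitary, `(N·L^k)`-periodic, plaquettes within `ε(L^k)^{−2}` of 1, NON-strict) is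
NOT literally [Balaban1985Variational]'s class (6) = `𝔘_k({Ω_j}, ε₀) ∩ 𝔅_k(𝔅_k, V)`: (6) has STRICT inequalities and carries
the current condition (1.9) `|(D*_U∂U)(b)| < ε₀L^{−2j}(L^jη)^{−1}` (DIVERGENCE D-s3-1).  The sandwich, however, uses class
MEMBERSHIP only for the admissibility of its two competitors (the averaged regular minimiser of run k+1; the regular
refinement of the run-k minimiser) — both of which are SMALL-FIELD configurations of a radius the regime controls.  Hence
the variational hypothesis can be taken over ANY level-indexed class family `𝒞` that CONTAINS a small-field ball
`sfClass d L N ε′` levelwise — in particular over (6) read exactly as printed (strict inequalities, current condition and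
all), once `(6)_{ε₀} ⊇ sfClass ε′` is checked for some `ε′` (e.g. `ε′ = ε₀/(2d)` by the crude bound
`|D*∂U(b)| ≤ Σ_{p ∋ b} ‖U(∂p) − 1‖`; that inclusion is a separate dictionary item, not proved here).

CONTENT (0 def, 0 sorry; composition of landed theorems BY NAME):
§1 `mem_sfClass_of_regularSup` (a `RegularSup b c j` configuration lies in `sfClass ε j` for `b ≤ ε`);
   `smoothRefine_of_subset` (`SmoothRefine` over `sfClass ε′` ⇒ `SmoothRefine` over any `𝒞 ⊇ sfClass ε′` levelwise, for
   radii `b, b′ ≤ ε′`).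
§2 **`actionRate_of_exists_approx_class`**: `𝒞 ⊇ sfClass d L N ε′` levelwise, (Rb) `2¹⁵(d+1)²(d+4)²L²b ≤ 1`,
   (Rr) `2¹⁰(d+1)(d+4)L²(b₁ + 8mL³/g) ≤ g`, (Rε′) `2·max b (b₁ + 8mL³/g) ≤ ε′`, `ApproxRefine d (sfClass d L N ε′) L N b c b₁ c₁ m`,
   and (H∃) OVER `𝒞` — «every datum of `dom` has at every level SOME minimiser over `𝒞` with sup-form regularity `(b, c)`» ⇒
   `ActionRate (minActReadings d 𝒞 L N dom loc) (wallConstNA(d,L)(gradConst d (max c (c₁ + 36mL³/g)) + (max b (b₁ + 8mL³/g))³)/L²) (L⁻²)`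
   (= `MinimalActionRateExists.actionRate_of_exists` over `𝒞` ∘ `smoothRefine_of_approxRefine` ∘ §1 ∘ `sideConds_of_regime`);
   **`actionRate_of_exists_approx_class_linear`** (the linear-bounds form, via `regime_of_linear_bounds`).
The `sfClass` ENDs of parts 2–4 are the case `𝒞 = sfClass d L N ε`, `ε′ = ε`.

HONEST FRAMING.  **NE3 is NOT proved**: (H∃) over `𝒞` ([Balaban1985Variational] Thm 1 p. 279 TYPE, GLOBAL reading — «the
minimal orbit of (5) on the class `𝒞` lies in (8)», journal l.9473) and `ApproxRefine` (crew leaf R1; unconditional in part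
3c) are hypotheses here; the LOCAL half of `T4EtaRateMin.NE3Shape` is untouched; spine PROVED count 0∕9.  No conditional of
the cell (`BetaPertH`, (B), (B^μ), G-an2-4) occurs; nothing printed is a hypothesis; no `def`, no `sorry`, axioms ⊆
{propext, Classical.choice, Quot.sound}.  Finite T⁴ rung (B)+1 — NOT infinite volume, NOT a mass gap, NOT the Clay problem,
NOT summit progress.  PLACEMENT (human rule 2026-08-19): `Summits/QuantumFields/BalabanUV/`.  HONEST DEPENDENCY (cell page
1): continuum YM on T⁴ ⇐ BetaPertH ∧ nine spine estimates (0/9 proved); BetaPertH ⇐ (D1) ∧ (D4) ∧ CAP+tail; G-an2-4 gates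
asym, D1 and NE2/3/4.
-/

set_option autoImplicit false

open scoped BigOperators Matrix Matrix.Norms.L2Operator Topology
open NormedSpace Filter

namespace Summit.QuantumFields.BalabanUV.T4Continuum.MinimalActionClassAgnostic

open Literature.MathematicalPhysics.QuantumFieldTheory.Balaban1983to89
open B7Prop1Explicit B7Prop2Explicit
open T4AveragingDeficitWall hiding Site Plane Plaq Bond
open T4AveragingDeficitNonAbelian (wallConstNA)
open T4EtaRateMin (Readings ActionRate)
open MinimalActionSandwich MinimalActionRate MinimalActionRefine SmoothRefineOfApprox ChainEndFix
open MinimalActionRateExists MinimalActionRegime MinimalActionFinalApprox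

noncomputable section

variable {d : ℕ} {n : Type*} [Fintype n] [DecidableEq n] [Nonempty n]

/-! ## §1 Small-field balls inside a class family -/

omit [Nonempty n] in
/-- A configuration with sup-form regularity `(b, c)` at level `j` lies in the small-field class of any radius `ε ≥ b`.
[folklore] -/
theorem mem_sfClass_of_regularSup {L N j : ℕ} {b c ε : ℝ} (hbε : b ≤ ε) {U : Site d → Fin d → (Matrix n n ℂ)ˣ}
    (h : RegularSup d L N b c j U) : U ∈ sfClass d L N ε j :=
  ⟨h.unitary, h.periodic, SmallField.mono h.small (div_le_div_of_nonneg_right hbε (by positivity))⟩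

omit [Nonempty n] in
/-- `SmoothRefine` passes from the small-field class `sfClass ε′` to ANY class family containing it levelwise, for radii
`b, b′ ≤ ε′` (the refinement only needs to be admissible, and it is a small field of radius `b′`). [folklore] -/
theorem smoothRefine_of_subset {𝒞 : ℕ → Set (Site d → Fin d → (Matrix n n ℂ)ˣ)} {L N : ℕ} {b c b' c' ε' : ℝ}
    (hsub : ∀ j, sfClass d L N ε' j ⊆ 𝒞 j) (hb : b ≤ ε') (hb' : b' ≤ ε')
    (hR : SmoothRefine d (sfClass (n := n) d L N ε') L N b c b' c') : SmoothRefine d 𝒞 L N b c b' c' := by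
  intro j U _ hreg
  obtain ⟨Ut, _, havg, hreg'⟩ := hR j U (mem_sfClass_of_regularSup hb hreg) hreg
  exact ⟨Ut, hsub (j + 1) (mem_sfClass_of_regularSup hb' hreg'), havg, hreg'⟩

/-! ## §2 The class-agnostic ENDs -/

/-- **ROUTE (A)'s ACTION HALF OVER ANY CLASS FAMILY CONTAINING A SMALL-FIELD BALL.**  Let `L, N ≥ 1`, `b, b₁, m ≥ 0`, and let
`𝒞` be a level-indexed class family with `sfClass d L N ε′ j ⊆ 𝒞 j` for all `j`.  Under the regime (Rb)
`2¹⁵(d+1)²(d+4)²L²·b ≤ 1`, (Rr) `2¹⁰(d+1)(d+4)L²·(b₁ + 8mL³/g) ≤ g`, (Rε′) `2·max b (b₁ + 8mL³/g) ≤ ε′` (`g = gap d L`):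
`ApproxRefine d (sfClass d L N ε′) L N b c b₁ c₁ m` (leaf R1) and (H∃) OVER `𝒞` — every datum of `dom` has at every level SOME
minimiser over `𝒞` with sup-form regularity `(b, c)` ([Balaban1985Variational] Thm 1 TYPE, a hypothesis) — give
`ActionRate (minActReadings d 𝒞 L N dom loc) (wallConstNA(d,L)(gradConst d (max c (c₁ + 36mL³/g)) + (max b (b₁ + 8mL³/g))³)/L²)
(L⁻²)`.  NE3 is NOT proved by this. [folklore] -/
theorem actionRate_of_exists_approx_class {𝒞 : ℕ → Set (Site d → Fin d → (Matrix n n ℂ)ˣ)} {L N : ℕ} (hL : 1 ≤ L)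
    (hN : 1 ≤ N) {b c b₁ c₁ m ε' : ℝ} (hb : 0 ≤ b) (hb₁ : 0 ≤ b₁) (hm : 0 ≤ m)
    (hsub : ∀ j, sfClass d L N ε' j ⊆ 𝒞 j)
    (hRb : 2 ^ 15 * ((d : ℝ) + 1) ^ 2 * ((d : ℝ) + 4) ^ 2 * (L : ℝ) ^ 2 * b ≤ 1)
    (hRr : 2 ^ 10 * ((d : ℝ) + 1) * ((d : ℝ) + 4) * (L : ℝ) ^ 2 * (b₁ + 8 * m * (L : ℝ) ^ 3 / gap d L) ≤ gap d L)
    (hRε : 2 * max b (b₁ + 8 * m * (L : ℝ) ^ 3 / gap d L) ≤ ε')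
    {dom : Set (Site d → Fin d → (Matrix n n ℂ)ˣ)}
    (hmin : ∀ V ∈ dom, ∀ k : ℕ, ∃ U, IsMinimiser d 𝒞 L N k V U ∧ RegularSup d L N b c k U)
    (hA : ApproxRefine d (sfClass (n := n) d L N ε') L N b c b₁ c₁ m)
    {X : Type*} (loc : ℕ → (Site d → Fin d → (Matrix n n ℂ)ˣ) → X → ℝ) :
    ActionRate (minActReadings d 𝒞 L N dom loc)
      (wallConstNA d L * (gradConst d (max c (c₁ + 36 * m * (L : ℝ) ^ 3 / gap d L))
        + (max b (b₁ + 8 * m * (L : ℝ) ^ 3 / gap d L)) ^ 3) / (L : ℝ) ^ 2) (((L : ℝ) ^ 2)⁻¹) := by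
  obtain ⟨hBs, hbε, hbs₁, hgap, hhalf, hε⟩ := sideConds_of_regime hL hb hb₁ hm hRb hRr hRε
  have hbs : 512 * (d + 1) * (d + 4) * (L : ℝ) ^ 2 * b ≤ 1 := by
    have h0 : (0 : ℝ) ≤ 512 * (d + 1) * (d + 4) * (L : ℝ) ^ 2 := by positivity
    exact (mul_le_mul_of_nonneg_left (le_max_left _ _) h0).trans hBs
  have hbε' : b ≤ ε' := by
    have h1 := le_max_left b (b₁ + 8 * m * (L : ℝ) ^ 3 / gap d L)
    have h2 : 0 ≤ max b (b₁ + 8 * m * (L : ℝ) ^ 3 / gap d L) := hb.trans h1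
    linarith
  -- the refinement shape over `𝒞`
  have hR : SmoothRefine d 𝒞 L N b c (b₁ + 8 * m * (L : ℝ) ^ 3 / gap d L) (c₁ + 36 * m * (L : ℝ) ^ 3 / gap d L) :=
    smoothRefine_of_subset hsub hbε' hε (smoothRefine_of_approxRefine hL hb₁ hm hbs₁ hgap hhalf hε hA)
  -- class transport of the averaged regular minimisers: into `sfClass ε′ k ⊆ 𝒞 k`
  refine actionRate_of_exists hL hN hb hBs hmin (fun V _ k U _ hreg => ?_) hR loc
  exact hsub k (rescale_bavg_mem_sfClass hL hb hbs hbε hreg.regular)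

/-- The LINEAR-BOUNDS form of `actionRate_of_exists_approx_class`: `b ≤ t`, `b₁ ≤ K·t`, `m ≤ K·t` (`K ≥ 1`), the two thresholds
`2¹⁵(d+1)²(d+4)²L²·t ≤ 1`, `2¹⁴(d+1)(d+4)L^{2d+3}·K·t ≤ 1`, and `18·K·L^{d+2}·t ≤ ε′`. [folklore] -/
theorem actionRate_of_exists_approx_class_linear (hd : 1 ≤ d) {𝒞 : ℕ → Set (Site d → Fin d → (Matrix n n ℂ)ˣ)}
    {L N : ℕ} (hL : 1 ≤ L) (hN : 1 ≤ N) {t K b c b₁ c₁ m ε' : ℝ} (ht : 0 ≤ t) (hK : 1 ≤ K) (hb : 0 ≤ b) (hb₁ : 0 ≤ b₁)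
    (hm : 0 ≤ m) (hbt : b ≤ t) (hb₁t : b₁ ≤ K * t) (hmt : m ≤ K * t)
    (hsub : ∀ j, sfClass d L N ε' j ⊆ 𝒞 j)
    (h1 : 2 ^ 15 * ((d : ℝ) + 1) ^ 2 * ((d : ℝ) + 4) ^ 2 * (L : ℝ) ^ 2 * t ≤ 1)
    (h2 : 2 ^ 14 * ((d : ℝ) + 1) * ((d : ℝ) + 4) * (L : ℝ) ^ (2 * d + 3) * K * t ≤ 1)
    (hεt : 18 * K * (L : ℝ) ^ (d + 2) * t ≤ ε')
    {dom : Set (Site d → Fin d → (Matrix n n ℂ)ˣ)}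
    (hmin : ∀ V ∈ dom, ∀ k : ℕ, ∃ U, IsMinimiser d 𝒞 L N k V U ∧ RegularSup d L N b c k U)
    (hA : ApproxRefine d (sfClass (n := n) d L N ε') L N b c b₁ c₁ m)
    {X : Type*} (loc : ℕ → (Site d → Fin d → (Matrix n n ℂ)ˣ) → X → ℝ) :
    ActionRate (minActReadings d 𝒞 L N dom loc)
      (wallConstNA d L * (gradConst d (max c (c₁ + 36 * m * (L : ℝ) ^ 3 / gap d L))
        + (max b (b₁ + 8 * m * (L : ℝ) ^ 3 / gap d L)) ^ 3) / (L : ℝ) ^ 2) (((L : ℝ) ^ 2)⁻¹) := by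
  obtain ⟨hRb, hRr, hRε⟩ := regime_of_linear_bounds hd hL ht hK hbt hb₁t hmt h1 h2
  exact actionRate_of_exists_approx_class hL hN hb hb₁ hm hsub hRb hRr (hRε.trans hεt) hmin hA loc

omit [Nonempty n] in
/-- The `sfClass` END of part 3 is the case `𝒞 = sfClass d L N ε` with any `ε′ ≤ ε` (monotonicity of the ball). [folklore] -/
theorem sfClass_subset_of_le {L N : ℕ} {ε' ε : ℝ} (hε : ε' ≤ ε) (j : ℕ) :
    sfClass (n := n) d L N ε' j ⊆ sfClass d L N ε j := fun _ hU =>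
  ⟨hU.1, hU.2.1, SmallField.mono hU.2.2 (div_le_div_of_nonneg_right hε (by positivity))⟩

end

end Summit.QuantumFields.BalabanUV.T4Continuum.MinimalActionClassAgnostic
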